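import Literature.NumberTheory.ComplexMultiplication.MainTheoremOfComplexMultiplicationHolds
import Literature.NumberTheory.ComplexMultiplication.CasselmanFiniteLevelReciprocity
import Literature.NumberTheory.ComplexMultiplication.CasselmanHeckeCharacterCMStructure
import Literature.NumberTheory.ComplexMultiplication.ShimuraTaniyamaOfMainTheoremAbelianScheme
import Literature.NumberTheory.GaloisRepresentations.HeckeCharacterWeakApproximation
import Literature.NumberTheory.GaloisRepresentations.HeckeCharacterRamificationProofs
import Literature.NumberTheory.GaloisRepresentations.IntegralGaloisActionProofs
import Literature.AlgebraicGeometry.Motives.GoodReductionProofs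
import Literature.AlgebraicGeometry.Motives.AbelianVarietyProjectiveChart
import Literature.AlgebraicGeometry.Motives.AbelianVarietyTateModuleFaithful
import Literature.AlgebraicGeometry.Motives.GaloisDescentAbelianVariety
import Literature.AlgebraicGeometry.Motives.AbelianVarietyEndGaloisDescent
import Literature.AlgebraicGeometry.Motives.AbelianVarietyStructureDescent
import Literature.AlgebraicGeometry.ComplexMultiplication.CMTypeRealisationIsogenyTransport
import Literature.AlgebraicGeometry.ComplexMultiplication.CMAbelianVarietyRealisedHolds
import Literature.AlgebraicGeometry.ComplexMultiplication.CMTypeRealisationOverNumberFieldUniformized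
import Literature.AlgebraicGeometry.ComplexMultiplication.CasselmanTwistedModel
import Literature.NumberTheory.ComplexMultiplication.CMTypeUniformization
import Literature.NumberTheory.ComplexMultiplication.MainTheoremOfComplexMultiplication
import Literature.NumberTheory.ComplexMultiplication.CasselmanLambdaFamily
import Literature.NumberTheory.ComplexMultiplication.CasselmanTwistIdeleIndependence
import Literature.NumberTheory.ComplexMultiplication.CasselmanReciprocityOfDescent
import Literature.NumberTheory.ComplexMultiplication.ShimuraReciprocityFrobenius
import Literature.NumberTheory.ComplexMultiplication.ShimuraTaniyamaOfMainTheorem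
import Literature.NumberTheory.ComplexMultiplication.CMDefinedOverNumberFieldOfQbar
import Literature.NumberTheory.ComplexMultiplication.CMDefinedOverQbarHolds
import Literature.NumberTheory.DiophantineGeometry.AbelianVarietyOrdinaryReduction
import HarnessLib

/-!
# [Shimura 1998] Thm. 21.4 (Casselman) — algebraic Hecke characters of CM type come from CM abelian varieties — holds:
# the named fact `shimura1998_thm21_4_casselman` PROVED under its exact name, from the Main Theorem of CM

G. Shimura, *Abelian Varieties with Complex Multiplication and Modular Functions* (Princeton 1998), §21.4 Thm. 21.4 (p. 192):
«there exists a structure `(A, 𝒞, ι)` of type `(K, Φ, 𝔞, ζ)` rational over `k` which determines `χ`», with «determines `χ`» read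
through Prop. 19.10 and the Frobenius sentence of Thm. 19.11's proof — the Literature named fact `shimura1998_thm21_4_casselman`
(`ComplexMultiplication/CasselmanHeckeCharacterCMStructure`; editions E-19.11♭1: Thm. 19.11's iff not recorded, and E-ST: the
Frobenius clause keyed on Serre–Tate good reduction «an abelian-scheme model over `𝓞_{k,v}`», [SerreTate1968] §1 p. 492).  The
tree proves it from [Shimura1998] Thm. 18.6 (the Main Theorem of Complex Multiplication), which is a Literature theorem
(`shimura1998_thm18_6_holds`, `ComplexMultiplication/MainTheoremOfComplexMultiplicationHolds`); this file is the Literature home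
of that derivation:

* Part 1 `finiteLevelReciprocity_binder` — finite-level reciprocity (p. 192 L12–14 via Prop. 21.1) in the binder's form, from
  `finiteLevelReciprocity` (`CasselmanFiniteLevelReciprocity`);
* Part 2 `cocycleDescent_holds` (RD ∘ TM ∘ FL ∘ 2a), `twistedGaloisModel_of_thm18_6` (the twisted Galois model from Thm. 18.6 (2)),
  `casselmanCore_of_facts` (the Casselman core «there exists a structure of type `(K, Φ)` rational over `k` which determines `χ`»
  from Prop. 26 and Thm. 18.6, by Weil descent with endomorphisms), `injective_of_isCMTypeRealisationOver`,
  `exists_prime_natCast_notMem`;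
* Part 3 `casselmanCore_of_thm18_6` — the core modulo Thm. 18.6 alone (`shimura1998_prop26_definedOverNumberField_holds`);
* Part 4 `casselmanST_of_thm18_6` — the binder's body from Thm. 18.6 alone (the family `(χ_τ)` from
  `shimuraTaniyama_heckeCharactersST_of_thm18_6`, and `χ_{τ₀} = χ` by comparing the two Frobenius descriptions on `T_ℓ A₀` at
  the cofinitely many good unramified places), and
  **`Literature.NumberTheory.ComplexMultiplication.shimura1998_thm21_4_casselman_holds`** — the named fact, PROVED under its
  exact name with NO hypothesis (`#print axioms` ⊆ {propext, Classical.choice, Quot.sound}).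

Theorems only: no definition, no NEW named fact (net: one Literature named fact discharged under its exact name).

Provenance: Literature home (namespace `Literature.NumberTheory.ComplexMultiplication.Casselman`) of the Summits-side
`CorCM/Hyp21/Hyp21FiniteLevelReciprocity` (Part 1), `HodgeConjecture/Theorems/HCCMUnconditionalH21OfFacts` §§ Layer 3 / Layer 2
(Part 2), the appendix of `…/HCCMUnconditionalH21OfThm186` (Part 3) and `casselmanST_of_thm18_6` of
`…/HCCMUnconditionalH21OfAbelianSchemeModel` (Part 4) (cell `hodgecm-mathlib`, fan A, binder `h21`; imports `Literature/` and
Mathlib only; their Summits closers `H21_proof` / `shimura1998_thm21_4_casselman_holds` of `…/HCCMUnconditionalH21` remain the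
closers of record of item stmt-HodgeConjecture-24834), which `Literature/` may not import. Lane `lit-hodgefound`, seat p20.

## References

* [Shimura1998] G. Shimura, *Abelian Varieties with Complex Multiplication and Modular Functions*, Princeton Univ. Press (1998):
  §21.4 Thm. 21.4 and its proof (p. 192); §21.1 Prop. 21.1 (pp. 189–191); Prop. 19.10 with (19.10g) (pp. 136–137); Thm. 19.11
  (proof) and Lemma 19.5 (p. 133); §18.6 Thm. 18.6; §12.4 Prop. 26; §5.2; §19.7.
* [SerreTate1968] J.-P. Serre, J. Tate, *Good reduction of abelian varieties*, Ann. of Math. 88 (1968), §1: definition of good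
  reduction (p. 492), Thm. 1 and Lemma 2; §7 Thm. 10–12.
* [Milne1986AbelianVarieties] J. S. Milne, *Abelian Varieties* (1986), §20 Rem. 20.9 (spreading out an abelian variety with its
  group law).
-/

set_option autoImplicit false

noncomputable section

open CategoryTheory IsDedekindDomain IsDedekindDomain.HeightOneSpectrum
open NumberField
open scoped NumberField ComplexConjugate nonZeroDivisors

namespace Literature.NumberTheory.ComplexMultiplication.Casselman

open Literature.AlgebraicGeometry.Motives
open Literature.NumberTheory.GaloisRepresentations
open Literature.NumberTheory.ComplexMultiplication
open Literature.NumberTheory.NumberFields.IdeleAction (ideleMulIdeal ideleMulEquiv)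
open Literature.NumberTheory.AdelicBaseChange (ideleRelNorm)
open Literature.AlgebraicGeometry.ComplexMultiplication (IsCMTypeRealisation exists_isCMTypeRealisation)
open Literature.NumberTheory.DiophantineGeometry (IsAbelianSchemeModel hasGoodReductionAt_of_exists_isAbelianSchemeModel)
open MonoidalCategory CartesianMonoidalCategory
open scoped MonObj

/-! ## Part 1: finite-level reciprocity (FL) in the binder's form -/

section Part1

/-- **Finite-level reciprocity (FL) in the binder's form** ([Shimura1998], proof of Thm. 21.4, p. 192 L12–14 «we can find a finite
Galois extension `k₂` of `k` containing `k₁` such that … `r(w)^σ = r(c_σ w)` for all `σ ∈ Gal(ℂ/k₂)`», via Prop. 21.1).  Under the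
hypotheses of Thm. 21.4 (the binder `shimura1998_thm21_4_casselman` verbatim), for a structure `(A₁, ι₁)` of type `(K, Φ)` over a
number field `k₁ ⊂ ℂ` uniformised by `ξ`, given the `λ`-family (`hlam`) and the lift-independence of `t = b·f(y)⁻¹` (`hindep`):
there is a finite Galois extension `k₂ ⊇ k k₁` of `k` such that every `σ₁ ∈ Aut(ℂ/k₁)` agreeing with a `σ ∈ Aut(ℂ/k)` that fixes
`k₂` satisfies `σ₁ · x_u = x_v` whenever `t u ≡ v (mod 𝔞)`.  Proof: the Literature theorem `finiteLevelReciprocity`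
(`CasselmanFiniteLevelReciprocity`); of the binder hypotheses only `hK` and the first conjunct of (19.10b) are used.
[cite: Shimura1998, §21.4 proof of Thm. 21.4 p. 192 L8–14; §21.1 Prop. 21.1 pp. 189–191] -/
theorem finiteLevelReciprocity_binder :
    ∀ (k : Type) [Field k] [NumberField k] [Algebra k ℂ] (K : Type) [Field K] [NumberField K]
      [IsCMField K] (Φ : CMType K) (τ₀ : K →+* ℂ) (χ : HeckeCharacter k),
    ((traceField Φ : Set ℂ) ⊆ Set.range (algebraMap k ℂ)) →
    χ.HasInfinityType (cmInfinityType Φ.1 τ₀ (algebraMap k ℂ)).1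
      (cmInfinityType Φ.1 τ₀ (algebraMap k ℂ)).2 →
    (∀ x : ideleGroup k, (x : AdeleRing (𝓞 k) k).1 = 1 →
      (∃ b : K, ((χ x : ℂˣ) : ℂ) = τ₀ b) ∧
        ((χ x : ℂˣ) : ℂ) * conj ((χ x : ℂˣ) : ℂ) = (((ideleNorm x)⁻¹ : ℝ) : ℂ)) →
    (∀ (v : HeightOneSpectrum (𝓞 k)) (u : (v.adicCompletionIntegers k)ˣ),
      ∃ b : (𝓞 K)ˣ, ((χ.localComponent v
        (Units.map ((v.adicCompletionIntegers k).subtype : _ →* _) u) : ℂˣ) : ℂ) =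
        τ₀ ((b : 𝓞 K) : K)) →
    (∀ v : HeightOneSpectrum (𝓞 k), ∃ π : 𝓞 K, χ.valueAtUniformizer v = τ₀ (π : K) ∧
      ∀ (L : Type) [Field L] [NumberField L] [Normal ℚ L] (ιL : L →+* ℂ) (j : K →+* L)
        (σL : k →+* L), ιL.comp σL = algebraMap k ℂ →
        IsReflexTypeNorm (valuedIn ιL Φ.1) j σL v.asIdeal (Ideal.span {π})) →
    ∀ (k₁ : Type) [Field k₁] [NumberField k₁] [Algebra k₁ ℂ] (A₁ : AbelianVariety k₁)
      (ι₁ : 𝓞 K →+* End A₁), IsCMTypeRealisationOver Φ A₁ ι₁ →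
    ∀ (𝔞 : (FractionalIdeal (𝓞 K)⁰ K)ˣ)
      (ξ : CMTypeUniformization Φ 𝔞 (A₁.baseChange ℂ) ((A₁.endBaseChange ℂ).comp ι₁)),
    (∀ [NumberField ↥(traceField Φ)] [Algebra ↥(traceField Φ) k] [IsScalarTower ↥(traceField Φ) k ℂ]
        (σ : ℂ ≃ₐ[k] ℂ) (y : ideleGroup k), IsArtinLift k y σ →
        ∀ b : Kˣ, ((χ ((infiniteIdeles k (HeckeCharacter.infPart k y))⁻¹ * y) : ℂˣ) : ℂ) = τ₀ (b : K) →
        ∃ lam : A₁.baseChange ℂ ≅ (A₁.baseChange ℂ).conjugate σ.toRingEquiv,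
          (∀ a : 𝓞 K, ((A₁.endBaseChange ℂ).comp ι₁ a : _ ⟶ _) ≫ lam.hom =
            lam.hom ≫ (((A₁.baseChange ℂ).endConjugate σ.toRingEquiv) ((A₁.endBaseChange ℂ).comp ι₁ a) : _ ⟶ _)) ∧
          ∀ u v : K,
            ideleMulEquiv (FiniteAdeleRing.unitEmbedding (𝓞 K) K b * (reflexNormFinitePart K Φ (traceField Φ) (ideleRelNorm (↥(traceField Φ)) k y))⁻¹)
              (𝔞 : FractionalIdeal (𝓞 K)⁰ K) 𝔞.ne_zero (Submodule.Quotient.mk u) = Submodule.Quotient.mk v →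
            (A₁.baseChange ℂ).conjPoints σ.toRingEquiv (ξ.r u) = AlgPoints.map lam.hom.hom.hom.hom (ξ.r v)) →
    (∀ [NumberField ↥(traceField Φ)] [Algebra ↥(traceField Φ) k] [IsScalarTower ↥(traceField Φ) k ℂ]
        (σ : ℂ ≃ₐ[k] ℂ) (y y' : ideleGroup k), IsArtinLift k y σ → IsArtinLift k y' σ →
        ∀ b b' : Kˣ, ((χ ((infiniteIdeles k (HeckeCharacter.infPart k y))⁻¹ * y) : ℂˣ) : ℂ) = τ₀ (b : K) →
          ((χ ((infiniteIdeles k (HeckeCharacter.infPart k y'))⁻¹ * y') : ℂˣ) : ℂ) = τ₀ (b' : K) →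
          FiniteAdeleRing.unitEmbedding (𝓞 K) K b *
              (reflexNormFinitePart K Φ (traceField Φ) (ideleRelNorm (↥(traceField Φ)) k y))⁻¹ =
            FiniteAdeleRing.unitEmbedding (𝓞 K) K b' *
              (reflexNormFinitePart K Φ (traceField Φ) (ideleRelNorm (↥(traceField Φ)) k y'))⁻¹) →
    ∃ (k₂ : Type) (_ : Field k₂) (_ : NumberField k₂) (_ : Algebra k k₂) (_ : Algebra k₂ ℂ)
      (_ : IsScalarTower k k₂ ℂ) (_ : FiniteDimensional k k₂) (_ : IsGalois k k₂)
      (_ : Algebra k₁ k₂) (_ : IsScalarTower k₁ k₂ ℂ),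
      ∀ [NumberField ↥(traceField Φ)] [Algebra ↥(traceField Φ) k] [IsScalarTower ↥(traceField Φ) k ℂ]
        (σ : ℂ ≃ₐ[k] ℂ) (σ₁ : ℂ ≃ₐ[k₁] ℂ), (∀ z : ℂ, σ₁ z = σ z) →
        (∀ x : k₂, σ (algebraMap k₂ ℂ x) = algebraMap k₂ ℂ x) →
        ∀ (y : ideleGroup k), IsArtinLift k y σ →
        ∀ b : Kˣ, ((χ ((infiniteIdeles k (HeckeCharacter.infPart k y))⁻¹ * y) : ℂˣ) : ℂ) = τ₀ (b : K) →
          ∀ u v : K,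
            ideleMulEquiv (FiniteAdeleRing.unitEmbedding (𝓞 K) K b * (reflexNormFinitePart K Φ (traceField Φ) (ideleRelNorm (↥(traceField Φ)) k y))⁻¹)
                    (𝔞 : FractionalIdeal (𝓞 K)⁰ K) 𝔞.ne_zero (Submodule.Quotient.mk u) = Submodule.Quotient.mk v →
            σ₁ • (A₁.pointsMulEquiv ℂ).symm (ξ.r u) = (A₁.pointsMulEquiv ℂ).symm (ξ.r v) := by
  intro k _ _ _ K _ _ _ Φ τ₀ χ hK _ hb _ _ k₁ _ _ _ A₁ ι₁ hA₁ 𝔞 ξ hlam hindep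
  exact finiteLevelReciprocity Φ τ₀ χ hK (fun x hx => (hb x hx).1) A₁ ι₁ hA₁ 𝔞 ξ hlam hindep

end Part1

/-! ## Part 2: the twisted Galois model, cocycle descent and the Casselman core from Thm. 18.6 and Prop. 26 -/

section Part2

/-- **Cocycle descent (Shimura p. 192 L9–17 + Prop. 21.1) = RD ∘ TM ∘ FL ∘ 2a.**  From the `λ`-family: a structure `(A₂, ι₂)`
of type `(K, Φ)` over a finite Galois `k₂ / k` inside `ℂ` with a semilinear `Gal(k₂/k)`-action `ρ` compatible with `μ, η, ι⁻¹`
and every `ι₂(a)`, every `k`-descent `(A₀, e, ι₀)` of which satisfies Shimura reciprocity (19.10g) for some uniformisation `ξ₁`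
of `A₀(ℂ)` of type `(K, Φ, 𝔞)`.  Proof: 2a `unitEmbedding_mul_reflexNormFinitePart_inv_eq_of_isArtinLift`, the idèle
independence `twistIdele…`, FL `finiteLevelReciprocity_binder`, TM `exists_twistedGaloisModel_of_finiteLevel`, RD
`exists_uniformization_shimuraReciprocity_of_descent` (all Literature).
[cite: Shimura1998, §21.4 proof p. 192 L9–17; §21.1 Prop. 21.1 pp. 189–191; (19.10g) p. 137] -/
theorem cocycleDescent_holds :
    ∀ (k : Type) [Field k] [NumberField k] [Algebra k ℂ] (K : Type) [Field K] [NumberField K]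
      [IsCMField K] (Φ : CMType K) (τ₀ : K →+* ℂ) (χ : HeckeCharacter k),
    ((traceField Φ : Set ℂ) ⊆ Set.range (algebraMap k ℂ)) →
    χ.HasInfinityType (cmInfinityType Φ.1 τ₀ (algebraMap k ℂ)).1
      (cmInfinityType Φ.1 τ₀ (algebraMap k ℂ)).2 →
    (∀ x : ideleGroup k, (x : AdeleRing (𝓞 k) k).1 = 1 →
      (∃ b : K, ((χ x : ℂˣ) : ℂ) = τ₀ b) ∧
        ((χ x : ℂˣ) : ℂ) * conj ((χ x : ℂˣ) : ℂ) = (((ideleNorm x)⁻¹ : ℝ) : ℂ)) →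
    (∀ (v : HeightOneSpectrum (𝓞 k)) (u : (v.adicCompletionIntegers k)ˣ),
      ∃ b : (𝓞 K)ˣ, ((χ.localComponent v
        (Units.map ((v.adicCompletionIntegers k).subtype : _ →* _) u) : ℂˣ) : ℂ) =
        τ₀ ((b : 𝓞 K) : K)) →
    (∀ v : HeightOneSpectrum (𝓞 k), ∃ π : 𝓞 K, χ.valueAtUniformizer v = τ₀ (π : K) ∧
      ∀ (L : Type) [Field L] [NumberField L] [Normal ℚ L] (ιL : L →+* ℂ) (j : K →+* L)
        (σL : k →+* L), ιL.comp σL = algebraMap k ℂ →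
        IsReflexTypeNorm (valuedIn ιL Φ.1) j σL v.asIdeal (Ideal.span {π})) →
    ∀ (k₁ : Type) [Field k₁] [NumberField k₁] [Algebra k₁ ℂ] (A₁ : AbelianVariety k₁)
      (ι₁ : 𝓞 K →+* End A₁), IsCMTypeRealisationOver Φ A₁ ι₁ →
    ∀ (𝔞 : (FractionalIdeal (𝓞 K)⁰ K)ˣ)
      (ξ : CMTypeUniformization Φ 𝔞 (A₁.baseChange ℂ) ((A₁.endBaseChange ℂ).comp ι₁)),
    (∀ [NumberField ↥(traceField Φ)] [Algebra ↥(traceField Φ) k] [IsScalarTower ↥(traceField Φ) k ℂ]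
        (σ : ℂ ≃ₐ[k] ℂ) (y : ideleGroup k), IsArtinLift k y σ →
        ∀ b : Kˣ, ((χ ((infiniteIdeles k (HeckeCharacter.infPart k y))⁻¹ * y) : ℂˣ) : ℂ) = τ₀ (b : K) →
        ∃ lam : A₁.baseChange ℂ ≅ (A₁.baseChange ℂ).conjugate σ.toRingEquiv,
          (∀ a : 𝓞 K, ((A₁.endBaseChange ℂ).comp ι₁ a : _ ⟶ _) ≫ lam.hom =
            lam.hom ≫ (((A₁.baseChange ℂ).endConjugate σ.toRingEquiv) ((A₁.endBaseChange ℂ).comp ι₁ a) : _ ⟶ _)) ∧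
          ∀ u v : K,
            ideleMulEquiv (FiniteAdeleRing.unitEmbedding (𝓞 K) K b * (reflexNormFinitePart K Φ (traceField Φ) (ideleRelNorm (↥(traceField Φ)) k y))⁻¹)
              (𝔞 : FractionalIdeal (𝓞 K)⁰ K) 𝔞.ne_zero (Submodule.Quotient.mk u) = Submodule.Quotient.mk v →
            (A₁.baseChange ℂ).conjPoints σ.toRingEquiv (ξ.r u) = AlgPoints.map lam.hom.hom.hom.hom (ξ.r v)) →
    ∃ (k₂ : Type) (_ : Field k₂) (_ : NumberField k₂) (_ : Algebra k k₂) (_ : Algebra k₂ ℂ)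
      (_ : IsScalarTower k k₂ ℂ) (_ : FiniteDimensional k k₂) (_ : IsGalois k k₂)
      (A₂ : AbelianVariety k₂) (ι₂ : 𝓞 K →+* End A₂)
      (ρ : Literature.AlgebraicGeometry.RelativeSpec.ActionOver
        (A₂.X.hom ≫ AbelianVariety.bcSpec k k₂) (k₂ ≃ₐ[k] k₂))
      (hρ : ∀ σ, (ρ.aut σ).hom ≫ A₂.X.hom = A₂.X.hom ≫ AbelianVariety.specAut k₂ σ⁻¹),
      IsCMTypeRealisationOver Φ A₂ ι₂ ∧
      (∀ σ, GaloisDescentAbelianVariety.aut₂ k₂ A₂ ρ hρ σ ≫ μ[A₂.X].left = μ[A₂.X].left ≫ (ρ.aut σ).hom) ∧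
      (∀ σ, η[A₂.X].left ≫ (ρ.aut σ).hom = AbelianVariety.specAut k₂ σ⁻¹ ≫ η[A₂.X].left) ∧
      (∀ σ, ι[A₂.X].left ≫ (ρ.aut σ).hom = (ρ.aut σ).hom ≫ ι[A₂.X].left) ∧
      (∀ σ (a : 𝓞 K), (ρ.aut σ).hom ≫ AbelianVariety.Hom.toSchemeHom (ι₂ a : A₂ ⟶ A₂) =
        AbelianVariety.Hom.toSchemeHom (ι₂ a : A₂ ⟶ A₂) ≫ (ρ.aut σ).hom) ∧
      ∀ (A₀ : AbelianVariety k) (e : A₂ ≅ A₀.baseChange k₂),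
        (∀ σ, (ρ.aut σ).hom ≫ AbelianVariety.Hom.toSchemeHom e.hom =
          AbelianVariety.Hom.toSchemeHom e.hom ≫ A₀.gal k₂ σ) →
        ∀ ι₀ : 𝓞 K →+* End A₀,
          (∀ a : 𝓞 K, (ι₂ a : A₂ ⟶ A₂) ≫ e.hom = e.hom ≫ AbelianVariety.Hom.baseChange k₂ (ι₀ a : A₀ ⟶ A₀)) →
      (∃ ξ₁ : CMTypeUniformization Φ 𝔞 A₀ ι₀,
      ∀ [NumberField ↥(traceField Φ)] [Algebra ↥(traceField Φ) k] [IsScalarTower ↥(traceField Φ) k ℂ]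
        (σ : ℂ ≃ₐ[k] ℂ) (y : ideleGroup k), IsArtinLift k y σ →
        ∀ b : Kˣ, ((χ ((infiniteIdeles k (HeckeCharacter.infPart k y))⁻¹ * y) : ℂˣ) : ℂ) = τ₀ (b : K) →
          ∀ u v : K,
            ideleMulEquiv (FiniteAdeleRing.unitEmbedding (𝓞 K) K b * (reflexNormFinitePart K Φ (traceField Φ) (ideleRelNorm (↥(traceField Φ)) k y))⁻¹)
              (𝔞 : FractionalIdeal (𝓞 K)⁰ K) 𝔞.ne_zero (Submodule.Quotient.mk u) = Submodule.Quotient.mk v →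
            σ • ξ₁.r u = ξ₁.r v) := by
  intro k _ _ _ K _ _ _ Φ τ₀ χ hK ha hb hu hπ k₁ _ _ _ A₁ ι₁ hA₁ 𝔞 ξ hlam
  have hindep := @unitEmbedding_mul_reflexNormFinitePart_inv_eq_of_isArtinLift k _ _ _ K _ _ _ Φ τ₀ χ hK ha hb hu hπ
  obtain ⟨k₂, _i1, _i2, _i3, _i4, _i5, _i6, _i7, _i8, _i9, hfl⟩ :=
    finiteLevelReciprocity_binder k K Φ τ₀ χ hK ha hb hu hπ k₁ A₁ ι₁ hA₁ 𝔞 ξ hlam hindep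
  obtain ⟨A₂, ι₂, ρ, hρ, h1, hmul, hone, hinv, hιρ, e₂, he₂, hlink⟩ :=
    Literature.AlgebraicGeometry.ComplexMultiplication.exists_twistedGaloisModel_of_finiteLevel
      k K Φ τ₀ χ hK ha hb hu hπ k₁ A₁ ι₁ hA₁ 𝔞 ξ hlam hindep k₂ hfl
  exact ⟨k₂, _i1, _i2, _i3, _i4, _i5, _i6, _i7, A₂, ι₂, ρ, hρ, h1, hmul, hone, hinv, hιρ,
    fun A₀ e he ι₀ hι ↦ exists_uniformization_shimuraReciprocity_of_descent k K Φ τ₀ χ hK ha hb hu hπ k₁ A₁ ι₁ hA₁ 𝔞 ξ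
      hlam hindep k₂ A₂ ι₂ ρ hρ e₂ he₂ hlink A₀ e he ι₀ hι⟩

/-- **The twisted Galois model from Thm. 18.6 (2).**  Under the hypotheses of Thm. 21.4 and given a structure `(A₁, ι₁)` of
type `(K, Φ)` over a number field `k₁ ⊂ ℂ` with a complex uniformisation `ξ` of type `(K, Φ, 𝔞)`: a finite Galois `k₂ / k`, a
structure `(A₂, ι₂)` of type `(K, Φ)` over `k₂` and a semilinear `Gal(k₂/k)`-action `ρ` compatible with the group law and `ι₂`,
such that every `ρ`-compatible `k`-form `(A₀, ι₀)` «determines `χ`» in the Frobenius form (19.10g).  Proof: the `λ`-family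
`exists_iso_conjugate_of_isArtinLift_of_thm18_6` (Thm. 18.6 (2)), `cocycleDescent_holds`, and `frobenius_of_shimuraReciprocity`.
[cite: Shimura1998, §18.6 Thm. 18.6 (2); §21.1 Prop. 21.1; §21.4 proof p. 192; (19.10g); Thm. 19.11] -/
theorem twistedGaloisModel_of_thm18_6 (h186 : shimura1998_thm18_6) :
    ∀ (k : Type) [Field k] [NumberField k] [Algebra k ℂ] (K : Type) [Field K] [NumberField K]
      [IsCMField K] (Φ : CMType K) (τ₀ : K →+* ℂ) (χ : HeckeCharacter k),
    ((traceField Φ : Set ℂ) ⊆ Set.range (algebraMap k ℂ)) →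
    χ.HasInfinityType (cmInfinityType Φ.1 τ₀ (algebraMap k ℂ)).1
      (cmInfinityType Φ.1 τ₀ (algebraMap k ℂ)).2 →
    (∀ x : ideleGroup k, (x : AdeleRing (𝓞 k) k).1 = 1 →
      (∃ b : K, ((χ x : ℂˣ) : ℂ) = τ₀ b) ∧
        ((χ x : ℂˣ) : ℂ) * conj ((χ x : ℂˣ) : ℂ) = (((ideleNorm x)⁻¹ : ℝ) : ℂ)) →
    (∀ (v : HeightOneSpectrum (𝓞 k)) (u : (v.adicCompletionIntegers k)ˣ),
      ∃ b : (𝓞 K)ˣ, ((χ.localComponent v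
        (Units.map ((v.adicCompletionIntegers k).subtype : _ →* _) u) : ℂˣ) : ℂ) =
        τ₀ ((b : 𝓞 K) : K)) →
    (∀ v : HeightOneSpectrum (𝓞 k), ∃ π : 𝓞 K, χ.valueAtUniformizer v = τ₀ (π : K) ∧
      ∀ (L : Type) [Field L] [NumberField L] [Normal ℚ L] (ιL : L →+* ℂ) (j : K →+* L)
        (σL : k →+* L), ιL.comp σL = algebraMap k ℂ →
        IsReflexTypeNorm (valuedIn ιL Φ.1) j σL v.asIdeal (Ideal.span {π})) →
    ∀ (k₁ : Type) [Field k₁] [NumberField k₁] [Algebra k₁ ℂ] (A₁ : AbelianVariety k₁)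
      (ι₁ : 𝓞 K →+* End A₁), IsCMTypeRealisationOver Φ A₁ ι₁ →
    ∀ 𝔞 : (FractionalIdeal (𝓞 K)⁰ K)ˣ,
      CMTypeUniformization Φ 𝔞 (A₁.baseChange ℂ) ((A₁.endBaseChange ℂ).comp ι₁) →
    ∃ (k₂ : Type) (_ : Field k₂) (_ : NumberField k₂) (_ : Algebra k k₂) (_ : Algebra k₂ ℂ)
      (_ : IsScalarTower k k₂ ℂ) (_ : FiniteDimensional k k₂) (_ : IsGalois k k₂)
      (A₂ : AbelianVariety k₂) (ι₂ : 𝓞 K →+* End A₂)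
      (ρ : Literature.AlgebraicGeometry.RelativeSpec.ActionOver
        (A₂.X.hom ≫ AbelianVariety.bcSpec k k₂) (k₂ ≃ₐ[k] k₂))
      (hρ : ∀ σ, (ρ.aut σ).hom ≫ A₂.X.hom = A₂.X.hom ≫ AbelianVariety.specAut k₂ σ⁻¹),
      IsCMTypeRealisationOver Φ A₂ ι₂ ∧
      (∀ σ, GaloisDescentAbelianVariety.aut₂ k₂ A₂ ρ hρ σ ≫ μ[A₂.X].left = μ[A₂.X].left ≫ (ρ.aut σ).hom) ∧
      (∀ σ, η[A₂.X].left ≫ (ρ.aut σ).hom = AbelianVariety.specAut k₂ σ⁻¹ ≫ η[A₂.X].left) ∧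
      (∀ σ, ι[A₂.X].left ≫ (ρ.aut σ).hom = (ρ.aut σ).hom ≫ ι[A₂.X].left) ∧
      (∀ σ (a : 𝓞 K), (ρ.aut σ).hom ≫ AbelianVariety.Hom.toSchemeHom (ι₂ a : A₂ ⟶ A₂) =
        AbelianVariety.Hom.toSchemeHom (ι₂ a : A₂ ⟶ A₂) ≫ (ρ.aut σ).hom) ∧
      ∀ (A₀ : AbelianVariety k) (e : A₂ ≅ A₀.baseChange k₂),
        (∀ σ, (ρ.aut σ).hom ≫ AbelianVariety.Hom.toSchemeHom e.hom =
          AbelianVariety.Hom.toSchemeHom e.hom ≫ A₀.gal k₂ σ) →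
        ∀ ι₀ : 𝓞 K →+* End A₀,
          (∀ a : 𝓞 K, (ι₂ a : A₂ ⟶ A₂) ≫ e.hom = e.hom ≫ AbelianVariety.Hom.baseChange k₂ (ι₀ a : A₀ ⟶ A₀)) →
      ∀ v : HeightOneSpectrum (𝓞 k), χ.IsUnramifiedAt v →
        ∃ π : 𝓞 K, χ.valueAtUniformizer v = τ₀ (π : K) ∧
          ∀ (ℓ : ℕ) [Fact ℓ.Prime], (ℓ : 𝓞 k) ∉ v.asIdeal →
            ∀ 𝔓 ∈ v.primesAbove, ∀ σ : Field.absoluteGaloisGroup k, IsArithFrobAt (𝓞 k) σ 𝔓 →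
              A₀.tateRep ℓ σ = AbelianVariety.tateModuleMap ℓ (ι₀ π : A₀ ⟶ A₀) := by
  intro k _ _ _ K _ _ _ Φ τ₀ χ hK ha hb hu hπ k₁ _ _ _ A₁ ι₁ hA₁ 𝔞 ξ
  have hlam := @exists_iso_conjugate_of_isArtinLift_of_thm18_6 h186 k _ _ _ K _ _ _ Φ τ₀ χ hK ha hb hu hπ k₁ _ _ _ A₁ ι₁ hA₁ 𝔞 ξ
  obtain ⟨k₂, _j1, _j2, _j3, _j4, _j5, _j6, _j7, A₂, ι₂, ρ, hρ, hA₂, hmul, hone, hinv, hιρ, hrec⟩ :=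
    cocycleDescent_holds k K Φ τ₀ χ hK ha hb hu hπ k₁ A₁ ι₁ hA₁ 𝔞 ξ hlam
  refine ⟨k₂, _j1, _j2, _j3, _j4, _j5, _j6, _j7, A₂, ι₂, ρ, hρ, hA₂, hmul, hone, hinv, hιρ, ?_⟩
  intro A₀ e he ι₀ hι
  have h₂' : IsCMTypeRealisationOver Φ (A₀.baseChange k₂) ((A₀.endBaseChange k₂).comp ι₀) :=
    (IsCMTypeRealisationOver.iff_of_iso e (fun a => by
      simpa only [RingHom.comp_apply, AbelianVariety.endBaseChange_apply] using hι a)).1 hA₂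
  exact frobenius_of_shimuraReciprocity k K Φ τ₀ χ hK ha hb hu hπ 𝔞 A₀ ι₀ (IsCMTypeRealisationOver.of_baseChange h₂')
    (hrec A₀ e he ι₀ hι)

/-! ### The Casselman core ⟸ Prop. 26 + twisted Galois model + Weil descent -/

/-- **The Casselman core (Shimura 1998 Thm. 21.4 verbatim, Frobenius form of «determines `χ`»), from the named facts
`shimura1998_prop26_definedOverNumberField` (§12.4 Prop. 26) and `shimura1998_thm18_6` (Thm. 18.6).**  «There exists a structure
`𝒫` of type `(K, Φ)` rational over `k` which determines `χ`» (p. 192), (19.10g) read on `ℓ`-power torsion at the good unramified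
places.  Proof: a structure over some number field (`forall_exists_isCMTypeRealisationOver_uniformization_of_prop26`), the
twisted Galois model `twistedGaloisModel_of_thm18_6`, and Weil descent with endomorphisms `AbelianVariety.exists_descent_with_end`;
the type `(K, Φ)` descends from `A₂` to the `k`-form `A₀` along `e : A₂ ≅ A₀ ⊗ k₂` (`IsCMTypeRealisationOver.iff_of_iso`,
`.of_baseChange`). [cite: Shimura1998, §21.4 Thm. 21.4 (proof, p. 192); §12.4 Prop. 26; §21.1 Prop. 21.1] -/
theorem casselmanCore_of_facts (h26 : shimura1998_prop26_definedOverNumberField) (h186 : shimura1998_thm18_6) :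
    ∀ (k : Type) [Field k] [NumberField k] [Algebra k ℂ] (K : Type) [Field K] [NumberField K]
      [IsCMField K] (Φ : CMType K) (τ₀ : K →+* ℂ) (χ : HeckeCharacter k),
    ((traceField Φ : Set ℂ) ⊆ Set.range (algebraMap k ℂ)) →
    χ.HasInfinityType (cmInfinityType Φ.1 τ₀ (algebraMap k ℂ)).1
      (cmInfinityType Φ.1 τ₀ (algebraMap k ℂ)).2 →
    (∀ x : ideleGroup k, (x : AdeleRing (𝓞 k) k).1 = 1 →
      (∃ b : K, ((χ x : ℂˣ) : ℂ) = τ₀ b) ∧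
        ((χ x : ℂˣ) : ℂ) * conj ((χ x : ℂˣ) : ℂ) = (((ideleNorm x)⁻¹ : ℝ) : ℂ)) →
    (∀ (v : HeightOneSpectrum (𝓞 k)) (u : (v.adicCompletionIntegers k)ˣ),
      ∃ b : (𝓞 K)ˣ, ((χ.localComponent v
        (Units.map ((v.adicCompletionIntegers k).subtype : _ →* _) u) : ℂˣ) : ℂ) =
        τ₀ ((b : 𝓞 K) : K)) →
    (∀ v : HeightOneSpectrum (𝓞 k), ∃ π : 𝓞 K, χ.valueAtUniformizer v = τ₀ (π : K) ∧
      ∀ (L : Type) [Field L] [NumberField L] [Normal ℚ L] (ιL : L →+* ℂ) (j : K →+* L)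
        (σL : k →+* L), ιL.comp σL = algebraMap k ℂ →
        IsReflexTypeNorm (valuedIn ιL Φ.1) j σL v.asIdeal (Ideal.span {π})) →
    ∃ (A₀ : AbelianVariety k) (ι₀ : 𝓞 K →+* End A₀),
      IsCMTypeRealisationOver Φ A₀ ι₀ ∧
      ∀ v : HeightOneSpectrum (𝓞 k), χ.IsUnramifiedAt v →
        ∃ π : 𝓞 K, χ.valueAtUniformizer v = τ₀ (π : K) ∧
          ∀ (ℓ : ℕ) [Fact ℓ.Prime], (ℓ : 𝓞 k) ∉ v.asIdeal →
            ∀ 𝔓 ∈ v.primesAbove, ∀ σ : Field.absoluteGaloisGroup k, IsArithFrobAt (𝓞 k) σ 𝔓 →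
              A₀.tateRep ℓ σ = AbelianVariety.tateModuleMap ℓ (ι₀ π : A₀ ⟶ A₀) := by
  intro k _ _ _ K _ _ _ Φ τ₀ χ hK ha hb hu hπ
  obtain ⟨k₁, _i1, _i2, _i3, A₁, ι₁, hA₁, 𝔞, ⟨ξ⟩⟩ :=
    Literature.AlgebraicGeometry.ComplexMultiplication.forall_exists_isCMTypeRealisationOver_uniformization_of_prop26 h26 K Φ
  obtain ⟨k₂, _j1, _j2, _j3, _j4, _j5, _j6, _j7, A₂, ι₂, ρ, hρ, hA₂, hmul, hone, hinv, hιρ, hfrob⟩ :=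
    twistedGaloisModel_of_thm18_6 h186 k K Φ τ₀ χ hK ha hb hu hπ k₁ A₁ ι₁ hA₁ 𝔞 ξ
  obtain ⟨A₀, e, ι₀, he, hι⟩ := AbelianVariety.exists_descent_with_end k₂ A₂ ρ hρ hmul hone hinv K ι₂ hιρ
  refine ⟨A₀, ι₀, ?_, hfrob A₀ e he ι₀ hι⟩
  have h₂' : IsCMTypeRealisationOver Φ (A₀.baseChange k₂) ((A₀.endBaseChange k₂).comp ι₀) :=
    (IsCMTypeRealisationOver.iff_of_iso e (fun a => by
      simpa only [RingHom.comp_apply, AbelianVariety.endBaseChange_apply] using hι a)).1 hA₂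
  exact IsCMTypeRealisationOver.of_baseChange h₂'

/-! ## Layer 1 (line a2): Casselman core + Shimura–Taniyama ⟹ binder -/

/-- **The `𝓞_K`-action of a structure of type `(K, Φ)` is injective** (the CM type is read through
a ring homomorphism `θ : K → End_ℂ H¹(A₀(ℂ), ℂ)` out of a field into the endomorphisms of a
non-zero space, `rk H¹ = [K : ℚ] > 0`, and `θ(a) = H¹(ι₀(a)_ℂ)`). [cite: Shimura1998, §5.2 and §19.7] -/
theorem injective_of_isCMTypeRealisationOver {k : Type} [Field k] [Algebra k ℂ] {K : Type} [Field K]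
    [NumberField K] {Φ : CMType K} {A₀ : AbelianVariety k} {ι₀ : 𝓞 K →+* End A₀}
    (h : IsCMTypeRealisationOver Φ A₀ ι₀) : Function.Injective ι₀ := by
  obtain ⟨θ, hθ⟩ := h
  obtain ⟨-, hrank, hcomp, -⟩ := hθ
  intro a b hab
  have hV : Nontrivial (Literature.AlgebraicGeometry.HodgeTheory.complexBetti (A₀.baseChange ℂ).X 1) := by
    apply Module.nontrivial_of_finrank_pos (R := ℂ)
    rw [hrank]
    exact Module.finrank_pos
  have hab' : ((A₀.endBaseChange ℂ).comp ι₀) a = ((A₀.endBaseChange ℂ).comp ι₀) b := by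
    simp only [RingHom.comp_apply, hab]
  have ha := hcomp a
  rw [hab', hcomp b] at ha
  have hK : (a : K) = (b : K) := θ.injective ha.symm
  exact NumberField.RingOfIntegers.ext hK

/-- **Some prime `ℓ` is prime to `v`** (of `2` and `3`, not both lie in the prime `v`). [cite: Shimura1998, §21.4 proof of Thm. 21.4 (p. 192)] -/
theorem exists_prime_natCast_notMem {k : Type} [Field k] [NumberField k]
    (v : HeightOneSpectrum (𝓞 k)) : ∃ ℓ : ℕ, ℓ.Prime ∧ (ℓ : 𝓞 k) ∉ v.asIdeal := by
  by_contra h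
  push Not at h
  have h2 := h 2 Nat.prime_two
  have h3 := h 3 Nat.prime_three
  have h1 : ((3 : ℕ) : 𝓞 k) - ((2 : ℕ) : 𝓞 k) ∈ v.asIdeal := v.asIdeal.sub_mem h3 h2
  have h1' : ((3 : ℕ) : 𝓞 k) - ((2 : ℕ) : 𝓞 k) = 1 := by push_cast; norm_num
  rw [h1'] at h1
  exact v.isPrime.ne_top ((Ideal.eq_top_iff_one _).2 h1)

end Part2

/-! ## Part 3: the Casselman core modulo Thm. 18.6 alone -/

section Part3

/-- **The Casselman core modulo Thm. 18.6 ALONE**: `casselmanCore_of_facts` with its hypothesis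
`shimura1998_prop26_definedOverNumberField` discharged by the Literature theorem `shimura1998_prop26_definedOverNumberField_holds`
(`CMDefinedOverQbarHolds`).  This is the Frobenius-form content of Thm. 21.4 that follows from the Main Theorem of CM with no
reduction-theory record. [cite: Shimura1998, §21.4 Thm. 21.4 (proof, p. 192); §12.4 Prop. 26; §21.1 Prop. 21.1] -/
theorem casselmanCore_of_thm18_6 (h186 : shimura1998_thm18_6) :
    ∀ (k : Type) [Field k] [NumberField k] [Algebra k ℂ] (K : Type) [Field K] [NumberField K]
      [IsCMField K] (Φ : CMType K) (τ₀ : K →+* ℂ) (χ : HeckeCharacter k),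
    ((traceField Φ : Set ℂ) ⊆ Set.range (algebraMap k ℂ)) →
    χ.HasInfinityType (cmInfinityType Φ.1 τ₀ (algebraMap k ℂ)).1
      (cmInfinityType Φ.1 τ₀ (algebraMap k ℂ)).2 →
    (∀ x : ideleGroup k, (x : AdeleRing (𝓞 k) k).1 = 1 →
      (∃ b : K, ((χ x : ℂˣ) : ℂ) = τ₀ b) ∧
        ((χ x : ℂˣ) : ℂ) * conj ((χ x : ℂˣ) : ℂ) = (((ideleNorm x)⁻¹ : ℝ) : ℂ)) →
    (∀ (v : HeightOneSpectrum (𝓞 k)) (u : (v.adicCompletionIntegers k)ˣ),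
      ∃ b : (𝓞 K)ˣ, ((χ.localComponent v
        (Units.map ((v.adicCompletionIntegers k).subtype : _ →* _) u) : ℂˣ) : ℂ) =
        τ₀ ((b : 𝓞 K) : K)) →
    (∀ v : HeightOneSpectrum (𝓞 k), ∃ π : 𝓞 K, χ.valueAtUniformizer v = τ₀ (π : K) ∧
      ∀ (L : Type) [Field L] [NumberField L] [Normal ℚ L] (ιL : L →+* ℂ) (j : K →+* L)
        (σL : k →+* L), ιL.comp σL = algebraMap k ℂ →
        IsReflexTypeNorm (valuedIn ιL Φ.1) j σL v.asIdeal (Ideal.span {π})) →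
    ∃ (A₀ : AbelianVariety k) (ι₀ : 𝓞 K →+* End A₀),
      IsCMTypeRealisationOver Φ A₀ ι₀ ∧
      ∀ v : HeightOneSpectrum (𝓞 k), χ.IsUnramifiedAt v →
        ∃ π : 𝓞 K, χ.valueAtUniformizer v = τ₀ (π : K) ∧
          ∀ (ℓ : ℕ) [Fact ℓ.Prime], (ℓ : 𝓞 k) ∉ v.asIdeal →
            ∀ 𝔓 ∈ v.primesAbove, ∀ σ : Field.absoluteGaloisGroup k, IsArithFrobAt (𝓞 k) σ 𝔓 →
              A₀.tateRep ℓ σ = AbelianVariety.tateModuleMap ℓ (ι₀ π : A₀ ⟶ A₀) :=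
  casselmanCore_of_facts shimura1998_prop26_definedOverNumberField_holds h186

end Part3

/-! ## Part 4: Thm. 21.4 in the binder's form (Frobenius clause keyed on Serre–Tate good reduction); the named fact HOLDS -/

section Part4

/-- **Shimura 1998 Thm. 21.4 (Casselman), FLAT reading, Frobenius clause keyed on SERRE–TATE good reduction — from the named
fact `shimura1998_thm18_6` ALONE** (the conclusion is the body of the binder `shimura1998_thm21_4_casselman` verbatim).  Under the
hypotheses of the binder (`k ⊇ K*`, (19.10a), (19.10b)) there is a structure `(A₀, ι₀)` of type `(K, Φ)` over `k` and the family
`(χ_τ)` of Prop. 19.10 with `χ_{τ₀} = χ` and, at every place `v` where `A₀` has an abelian-scheme model over `𝓞_{k,v}`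
([SerreTate1968] §1), the Frobenius element `π ∈ 𝓞_K` with `χ_τ(ϖ_v) = τ(π)` and «Frobenius acts on `T_ℓ A₀` as `ι₀(π)`».
Shimura p. 192, last paragraph: `(A₀, ι₀)` from the Casselman core (`casselmanCore_of_thm18_6`), `(χ_τ)` from
`shimuraTaniyama_heckeCharactersST_of_thm18_6` (`ShimuraTaniyamaOfMainTheoremAbelianScheme`); at the cofinitely many places with
an abelian-scheme model (`exists_finite_forall_exists_isAbelianSchemeModel`) and unramified for `χ`, `ι₀ π = ι₀ π'` on `T_ℓ A₀`
forces `π = π'`, hence `χ_{τ₀} = χ` (`HeckeCharacter.ext_of_eventually_valueAtUniformizer_eq`).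
[cite: Shimura1998, §21.4 Thm. 21.4 (proof, p. 192); Prop. 19.10, (19.10g); Thm. 19.11 (proof) with Lemma 19.5; §18.6 Thm. 18.6]
[cite: SerreTate1968, §1 (definition), Thm. 1; §7 Thm. 10–12] -/
theorem casselmanST_of_thm18_6 (h186 : shimura1998_thm18_6) :
    ∀ (k : Type) [Field k] [NumberField k] [Algebra k ℂ] (K : Type) [Field K] [NumberField K]
      [IsCMField K] (Φ : CMType K) (τ₀ : K →+* ℂ) (χ : HeckeCharacter k),
    ((traceField Φ : Set ℂ) ⊆ Set.range (algebraMap k ℂ)) →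
    χ.HasInfinityType (cmInfinityType Φ.1 τ₀ (algebraMap k ℂ)).1
      (cmInfinityType Φ.1 τ₀ (algebraMap k ℂ)).2 →
    (∀ x : ideleGroup k, (x : AdeleRing (𝓞 k) k).1 = 1 →
      (∃ b : K, ((χ x : ℂˣ) : ℂ) = τ₀ b) ∧
        ((χ x : ℂˣ) : ℂ) * conj ((χ x : ℂˣ) : ℂ) = (((ideleNorm x)⁻¹ : ℝ) : ℂ)) →
    (∀ (v : HeightOneSpectrum (𝓞 k)) (u : (v.adicCompletionIntegers k)ˣ),
      ∃ b : (𝓞 K)ˣ, ((χ.localComponent v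
        (Units.map ((v.adicCompletionIntegers k).subtype : _ →* _) u) : ℂˣ) : ℂ) =
        τ₀ ((b : 𝓞 K) : K)) →
    (∀ v : HeightOneSpectrum (𝓞 k), ∃ π : 𝓞 K, χ.valueAtUniformizer v = τ₀ (π : K) ∧
      ∀ (L : Type) [Field L] [NumberField L] [Normal ℚ L] (ιL : L →+* ℂ) (j : K →+* L)
        (σL : k →+* L), ιL.comp σL = algebraMap k ℂ →
        IsReflexTypeNorm (valuedIn ιL Φ.1) j σL v.asIdeal (Ideal.span {π})) →
    ∃ (A₀ : AbelianVariety k) (ι₀ : 𝓞 K →+* End A₀), IsCMTypeRealisationOver Φ A₀ ι₀ ∧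
      ∃ χfam : (K →+* ℂ) → HeckeCharacter k, χfam τ₀ = χ ∧
        ∀ v : HeightOneSpectrum (𝓞 k),
          (∃ (𝒜 : SchemeOver (valuationSubringAtPrime k v)) (_ : GrpObj 𝒜), IsAbelianSchemeModel A₀ v 𝒜) →
          ∃ π : 𝓞 K,
            (∀ τ : K →+* ℂ, (χfam τ).valueAtUniformizer v = τ (π : K)) ∧
            (∀ (ℓ : ℕ) [Fact ℓ.Prime], (ℓ : 𝓞 k) ∉ v.asIdeal →
              ∀ 𝔓 ∈ v.primesAbove, ∀ σ : Field.absoluteGaloisGroup k, IsArithFrobAt (𝓞 k) σ 𝔓 →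
                A₀.tateRep ℓ σ = AbelianVariety.tateModuleMap ℓ (ι₀ π : A₀ ⟶ A₀)) := by
  have hcore := casselmanCore_of_thm18_6 h186
  have hST := shimuraTaniyama_heckeCharactersST_of_thm18_6 h186
  intro k _ _ _ K _ _ _ Φ τ₀ χ hK ha hb hu hπ
  obtain ⟨A₀, ι₀, hreal, hfrob⟩ := hcore k K Φ τ₀ χ hK ha hb hu hπ
  obtain ⟨χfam, -, -, -, -, h5⟩ := hST k K Φ A₀ ι₀ hreal
  have hιinj : Function.Injective ι₀ := injective_of_isCMTypeRealisationOver hreal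
  -- cofinitely many abelian-scheme places (spreading out the group law — no r₀)
  have hgood : ∀ᶠ v : HeightOneSpectrum (𝓞 k) in Filter.cofinite,
      ∃ (𝒜 : SchemeOver (valuationSubringAtPrime k v)) (_ : GrpObj 𝒜), IsAbelianSchemeModel A₀ v 𝒜 := by
    obtain ⟨S, hS, hout⟩ := AbelianVariety.exists_finite_forall_exists_isAbelianSchemeModel A₀
    exact Filter.eventually_cofinite.2 (hS.subset fun v hv => by
      by_contra hvS
      exact hv (hout v hvS))
  -- cofinitely many unramified places
  have hunr : ∀ᶠ v in Filter.cofinite, χ.IsUnramifiedAt v :=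
    (χ.finite_ramifiedPlaces_iff).1 (HeckeCharacter.finite_ramifiedPlaces_holds χ)
  -- the two Frobenius descriptions agree there
  have hev : ∀ᶠ v in Filter.cofinite, (χfam τ₀).valueAtUniformizer v = χ.valueAtUniformizer v := by
    refine (hgood.and hunr).mono fun v hv => ?_
    obtain ⟨hv1, hv2⟩ := hv
    obtain ⟨π, hπval, hπfrob, -⟩ := h5 v hv1
    obtain ⟨π', hπ'val, hπ'frob⟩ := hfrob v hv2
    obtain ⟨ℓ, hℓprime, hℓv⟩ := exists_prime_natCast_notMem v
    haveI : Fact ℓ.Prime := ⟨hℓprime⟩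
    obtain ⟨𝔓, h𝔓⟩ := v.primesAbove_nonempty
    obtain ⟨σ, hσ⟩ :=
      IsDedekindDomain.HeightOneSpectrum.exists_isArithFrobAt_of_mem_primesAbove_holds (K := k) (v := v) h𝔓
    have e1 := hπfrob ℓ hℓv 𝔓 h𝔓 σ hσ
    have e2 := hπ'frob ℓ hℓv 𝔓 h𝔓 σ hσ
    have hℓk : (ℓ : k) ≠ 0 := Nat.cast_ne_zero.2 hℓprime.ne_zero
    have hιeq : (ι₀ π : A₀ ⟶ A₀) = ι₀ π' :=
      AbelianVariety.hom_ext_of_tateModuleMap_eq ℓ hℓk (e1.symm.trans e2)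
    have hππ' : π = π' := hιinj hιeq
    rw [hπval τ₀, hπ'val, hππ']
  have heq : χfam τ₀ = χ := HeckeCharacter.ext_of_eventually_valueAtUniformizer_eq hev
  refine ⟨A₀, ι₀, hreal, χfam, heq, fun v hv => ?_⟩
  obtain ⟨π, hπa, hπb, -⟩ := h5 v hv
  exact ⟨π, hπa, hπb⟩

/-- **[Shimura 1998, Thm. 21.4] (Casselman) — the named fact `shimura1998_thm21_4_casselman` HOLDS, with NO hypothesis**
(exact name; editions E-19.11♭1 + E-ST reading of the tree's statement): `casselmanST_of_thm18_6` at the Literature theorem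
`shimura1998_thm18_6_holds` ([Shimura1998] Thm. 18.6, `ComplexMultiplication/MainTheoremOfComplexMultiplicationHolds`).
[cite: Shimura1998, §21.4 Thm. 21.4 (proof, p. 192); Prop. 19.10; §18.6 Thm. 18.6] [cite: SerreTate1968, §1 Thm. 1; §7 Thm. 10–12] -/
theorem _root_.Literature.NumberTheory.ComplexMultiplication.shimura1998_thm21_4_casselman_holds :
    shimura1998_thm21_4_casselman :=
  casselmanST_of_thm18_6 shimura1998_thm18_6_holds

end Part4

end Literature.NumberTheory.ComplexMultiplication.Casselman

end
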